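import Summits.HodgeConjecture.HodgeConjecture.Theorems.GenericDivisibilityGenericDivisibilityBoundedSupportedTop
import Summits.HodgeConjecture.HodgeConjecture.Theorems.GenericDivisibilityGenericDivisibilityBoundedCruxAtOfSurjective
import Literature.AlgebraicGeometry.HodgeTheory.MotivatedClassesProofs
import Literature.AlgebraicGeometry.HodgeTheory.ComplexOrientationDegreeOne
import HarnessLib

/-!
# The heart of line `finite-level-bootstrap` (crux C2 `GenericDivisibilityBounded`,
# stmt-HodgeConjecture-18467) descends along surjective morphisms of degree prime to `ℓ`

Registered sub-goal `stub_heartOfHasDegreeCoprime` (lead c4, wave 2). Sorry-free, definition-free.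
`X'`, `X` are smooth projective over `ℂ` of the same dimension `n`, `f : X' ⟶ X` a `ℂ`-morphism,
`f(ℂ) = AlgPoints.mapContinuous f : X'(ℂ) → X(ℂ)`, `μ`, `ν` INTEGRAL orientations of the closed
`2n`-manifolds `X'(ℂ)`, `X(ℂ)`, `f` of degree `d` for them (`f(ℂ)_* [X'(ℂ)]_μ = d • [X(ℂ)]_ν`,
`HasDegree`), and `f_! = gysinMap μ ν f(ℂ) : H^k(X'(ℂ);ℤ) → H^k(X(ℂ);ℤ)` (`k + q = 2n`) the integral
Gysin map (Fulton, Young Tableaux App. B (5)). As in the funnel file `…LevelCleanFunnel`, spelled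
inline: `z| = z|_{(X∖Z)(ℂ)}`; "`x ∈ GT(X)`" (generically torsion): `∃ Z` closed `≠ univ`, `∃ N ≥ 1`,
`N • x| = 0`; "`D'(m, z)`": `∃ Z` closed `≠ univ`, `∃ y`, `∃ M ≥ 1`, `M • (z| - m • y) = 0`; "level
`ℓ^s` is CLEAN at `X`" (the heart `stub_finiteLevel` at one `X`): `∀ z, D'(ℓ^s, z) → ∃ w,
z - ℓ • w ∈ GT(X)`.

## Main results

* `genericDivisibilityBounded_levelDivisible_map` — `D'(m, z) ⇒ D'(m, f^* z)` for `f` onto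
  (witnesses `(f⁻¹Z, (f|)^* y, M)`; restriction commutes with pull-back,
  `genericDivisibilityBounded_restrict_map`).
* `genericDivisibilityBounded_ringChange_gysinMap_eq_smul` — **the integral Gysin map complexifies
  to a multiple of a complex Gysin map**: for closed connected oriented manifolds `Y`, `X`,
  integral orientations `μ`, `ν` and complex orientations `μ'`, `ν'` (`ν'` with Poincaré duality),
  `(f_!^{μ,ν} u) ⊗ ℂ = c • f_!^{μ',ν'} (u ⊗ ℂ)` for a scalar `c ≠ 0` (both are `PD⁻¹ ∘ f_* ∘ PD`,
  the changes of coefficients commute with cap products and push-forwards,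
  `[X]_ν ⊗ 1 = c_X • [X]_{ν'}` with `c_X ≠ 0` and `[Y]_μ ⊗ 1 = c_Y • [Y]_{μ'}` on the lines
  `H_top(–;ℂ)`; `c = c_X⁻¹ c_Y`).
* `genericDivisibilityBounded_gysinMap_genericallyTorsion` — **`f_!(GT(X')) ⊆ GT(X)`** for smooth
  projective `X'`, `X` with `dim X' ≤ dim X`: `GT = N¹ ∩ H_ℤ` on both sides
  (`…_genericallyTorsion_iff_ringChange_mem_supportedClasses`, landed p160596), the previous lemma,
  and Gysin maps keep coniveau (`gysinMap_mem_supportedClasses_of_isSmoothProjective`, Voisin II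
  Prop. 9.21 (ii)).
* `genericDivisibilityBounded_levelClean_of_hasDegree` — **the heart DESCENDS along `f` onto of
  degree `d` prime to `ℓ`**: `D'(ℓ^s, z) ⇒ D'(ℓ^s, f^*z) ⇒ f^*z - ℓ w' ∈ GT(X') ⇒
  d • z - ℓ • f_! w' = f_!(f^*z - ℓ w') ∈ GT(X)` (`f_! f^* = d`, `gysinMap_map_of_hasDegree`), and
  with `a ℓ + b d = 1`: `z - ℓ • (a z + b f_! w') = b • (d z - ℓ f_! w') ∈ GT(X)`.
* `genericDivisibilityBounded_levelClean_of_isBirational` — the case `σ : X' ⟶ X` birational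
  (`d = 1` for the complex orientations, `hasDegree_one_complexOrientationInt_of_isBirational`;
  onto since proper birational): **the heart at any smooth birational model gives the heart at
  `X`**, at every `ℓ`, `s`.
* `stub_heartOfHasDegreeCoprime` — the registered signature, verbatim (`n = k = q = 2p`).

References: [FultonYoungTableaux1997] App. B §B.1 (5)–(7); [VoisinHodgeII2003] §9.2.4
Prop. 9.21 (ii); [HatcherAT2002] §3.1, §3.3 Thm. 3.26, Thm. 3.30, p. 235; [Fulton1998] Lemma 19.1.2;
[ColliotTheleneVoisin2012] §3.
-/

set_option linter.dupNamespace false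

noncomputable section

namespace Summit.HodgeConjecture.HodgeConjecture.Theorems

open CategoryTheory AlgebraicGeometry
open Literature.AlgebraicGeometry.Motives Literature.AlgebraicGeometry.HodgeTheory
  Literature.AlgebraicTopology.SingularHomology

/-- Restriction `H^k(X(ℂ);ℤ) → H^k((X∖Z)(ℂ);ℤ)`, the very term of the route decls
(notation only). -/
local notation3 (prettyPrint := false) "Res[" X ", " Z ", " k "]" =>
  singularCohomology.map ℤ ℤ
    (⟨Subtype.val, continuous_subtype_val⟩ : C(complexPointsCompl X Z, ComplexPoints X)) k

/-! ### Two pieces of algebra -/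

/-- Bézout in an abelian group: if `a ℓ + b d = 1` then
`z - ℓ • (a • z + b • g) = b • (d • z - ℓ • g)` (`z = (a ℓ + b d) • z`). [folklore] -/
theorem genericDivisibilityBounded_bezout_smul {M : Type*} [AddCommGroup M] {a b d : ℤ} {ℓ : ℕ}
    (hab : a * ℓ + b * d = 1) (z g : M) :
    z - ℓ • (a • z + b • g) = b • (d • z - ℓ • g) := by
  have hz : z = (a * ℓ + b * d) • z := by rw [hab, one_smul]
  nth_rewrite 1 [hz]
  module

/-- `GT` is closed under `ℤ`-multiples (restriction is additive). [folklore] -/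
theorem genericDivisibilityBounded_genericallyTorsion_zsmul {X : SchemeOver ℂ} {k : ℕ}
    {x : singularCohomology ℤ ℤ (ComplexPoints X) k} (c : ℤ)
    (hx : ∃ Z : Set X.left, IsClosed Z ∧ Z ≠ Set.univ ∧ ∃ N : ℕ, 1 ≤ N ∧ N • Res[X, Z, k] x = 0) :
    ∃ Z : Set X.left, IsClosed Z ∧ Z ≠ Set.univ ∧ ∃ N : ℕ, 1 ≤ N ∧
      N • Res[X, Z, k] (c • x) = 0 := by
  obtain ⟨Z, hZ, hZne, N, hN, hx⟩ := hx
  exact ⟨Z, hZ, hZne, N, hN, by rw [map_zsmul, smul_comm, hx, zsmul_zero]⟩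

/-! ### The level hypothesis `D'(m, z)` pulls back along a morphism which is onto -/

/-- **`D'(m, z) ⇒ D'(m, f^* z)` for `f : X' ⟶ X` onto.** If `M • (z|_{(X∖Z)(ℂ)} - m • y) = 0` with
`Z` closed `≠ X`, then `M • ((f^* z)|_{(X'∖f⁻¹Z)(ℂ)} - m • (f|)^* y) = 0`, and `f⁻¹Z` is closed
`≠ X'`: apply `(f|)^*`, `f| = complexPointsComplMap f Z : (X'∖f⁻¹Z)(ℂ) → (X∖Z)(ℂ)`, and use that
restriction commutes with pull-back (`genericDivisibilityBounded_restrict_map`, Hatcher §3.1).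
[cite: HatcherAT2002, §3.1] -/
theorem genericDivisibilityBounded_levelDivisible_map {X' X : SchemeOver ℂ} (f : X' ⟶ X)
    (hf : Function.Surjective f.left.base) {k : ℕ} (m : ℕ)
    {z : singularCohomology ℤ ℤ (ComplexPoints X) k}
    (hz : ∃ Z : Set X.left, IsClosed Z ∧ Z ≠ Set.univ ∧
      ∃ (y : singularCohomology ℤ ℤ (complexPointsCompl X Z) k) (M : ℕ), 1 ≤ M ∧
        M • (Res[X, Z, k] z - m • y) = 0) :
    ∃ Z' : Set X'.left, IsClosed Z' ∧ Z' ≠ Set.univ ∧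
      ∃ (y' : singularCohomology ℤ ℤ (complexPointsCompl X' Z') k) (M : ℕ), 1 ≤ M ∧
        M • (Res[X', Z', k] (singularCohomology.map ℤ ℤ (AlgPoints.mapContinuous (L := ℂ) f) k z) -
          m • y') = 0 := by
  obtain ⟨Z, hZ, hZne, y, M, hM, hMz⟩ := hz
  refine ⟨f.left.base ⁻¹' Z, hZ.preimage f.left.continuous,
    genericDivisibilityBounded_preimage_ne_univ f hf hZne,
    singularCohomology.map ℤ ℤ (complexPointsComplMap f Z) k y, M, hM, ?_⟩
  have h := congrArg (singularCohomology.map ℤ ℤ (complexPointsComplMap f Z) k) hMz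
  rw [map_zero, map_nsmul, map_sub, map_nsmul, ← genericDivisibilityBounded_restrict_map] at h
  exact h

/-! ### The integral Gysin map, complexified -/

/-- **The integral Gysin map complexifies to a multiple of a complex Gysin map.** Let `Y`, `X` be
closed connected manifolds of dimensions `m`, `n` with integral orientations `μ`, `ν` and complex
orientations `μ'`, `ν'`, `ν'` satisfying Poincaré duality, `F : Y → X`, `a + q = m`, `b + q = n`.
Then for some `c ∈ ℂ`, `c ≠ 0`: `(F_!^{μ,ν} u) ⊗ ℂ = c • F_!^{μ',ν'} (u ⊗ ℂ)` for all
`u ∈ Hᵃ(Y;ℤ)`. Proof (Fulton App. B (5): `F_! = PD_X⁻¹ ∘ F_* ∘ PD_Y`): `ν` has Poincaré duality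
(Hatcher Thm. 3.30, the tree's `poincare_duality`), so `F_! u ⌢ [X]_ν = F_*(u ⌢ [Y]_μ)`
(`capProduct_gysinMap`); the changes of coefficients `ℤ → ℂ` commute with cap products and
push-forwards (`singularHomology.coeffChange_capProduct`, `singularHomology.coeffChange_map`); on
the lines `H_n(X;ℂ)`, `H_m(Y;ℂ)` (Hatcher Thm. 3.26) `[X]_ν ⊗ 1 = c_X • [X]_{ν'}` with `c_X ≠ 0`
(`[X]_ν ⊗ 1 ≠ 0`, `coeffChange_fundamentalClass_ne_zero`) and `[Y]_μ ⊗ 1 = c_Y • [Y]_{μ'}`,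
`c_Y ≠ 0`; hence `c_X • ((F_! u) ⊗ ℂ ⌢ [X]_{ν'}) = c_Y • (F_!' (u ⊗ ℂ) ⌢ [X]_{ν'})`, and
`⌢ [X]_{ν'}` is one-to-one; `c = c_X⁻¹ c_Y`.
[cite: FultonYoungTableaux1997, Appendix B §B.1 (5)]
[cite: HatcherAT2002, §3.3 Thm. 3.26 and Thm. 3.30] -/
theorem genericDivisibilityBounded_ringChange_gysinMap_eq_smul {Y X : Type} [TopologicalSpace Y]
    [TopologicalSpace X] [CompactSpace Y] [T2Space Y] [ConnectedSpace Y] [CompactSpace X]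
    [T2Space X] [ConnectedSpace X] {m n : ℕ} [ChartedSpace (EuclideanSpace ℝ (Fin m)) Y]
    [ChartedSpace (EuclideanSpace ℝ (Fin n)) X]
    (μ : HomologicalOrientation ℤ Y m) (ν : HomologicalOrientation ℤ X n)
    (μ' : HomologicalOrientation ℂ Y m) (ν' : HomologicalOrientation ℂ X n)
    (hν' : ν'.HasPoincareDuality) (F : C(Y, X)) {a b q : ℕ} (ha : a + q = m) (hb : b + q = n) :
    ∃ c : ℂ, c ≠ 0 ∧ ∀ u : singularCohomology ℤ ℤ Y a,
      singularCohomology.ringChange (Int.castRingHom ℂ) X b (gysinMap μ ν F ha hb u) =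
        c • gysinMap μ' ν' F ha hb (singularCohomology.ringChange (Int.castRingHom ℂ) Y a u) := by
  have hν : ν.HasPoincareDuality :=
    HomologicalOrientation.HasPoincareDuality.of_bijective_poincareDualityMap
      (fun p q h ↦ poincare_duality _ h)
  -- the complexified integral fundamental classes on the lines `H_n(X;ℂ)`, `H_m(Y;ℂ)`
  obtain ⟨cX, hcX⟩ := exists_eq_smul_fundamentalClass_of_connectedSpace ν'
    (singularHomology.coeffChange X (Int.castRingHom ℂ).toAddMonoidHom n ν.fundamentalClass)
  obtain ⟨cY, hcY⟩ := exists_eq_smul_fundamentalClass_of_connectedSpace μ'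
    (singularHomology.coeffChange Y (Int.castRingHom ℂ).toAddMonoidHom m μ.fundamentalClass)
  have hcX0 : cX ≠ 0 := by
    rintro rfl
    rw [zero_smul] at hcX
    exact Literature.Geometry.Manifold.coeffChange_fundamentalClass_ne_zero ℂ ν hcX
  have hcY0 : cY ≠ 0 := by
    rintro rfl
    rw [zero_smul] at hcY
    exact Literature.Geometry.Manifold.coeffChange_fundamentalClass_ne_zero ℂ μ hcY
  refine ⟨cX⁻¹ * cY, mul_ne_zero (inv_ne_zero hcX0) hcY0, fun u ↦ ?_⟩
  -- the defining square `F_! u ⌢ [X] = F_*(u ⌢ [Y])`, read through `⊗ ℂ`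
  have e1 : capProduct hb
        (singularCohomology.ringChange (Int.castRingHom ℂ) X b (gysinMap μ ν F ha hb u))
        (singularHomology.coeffChange X (Int.castRingHom ℂ).toAddMonoidHom n ν.fundamentalClass) =
      singularHomology.map ℂ ℂ F q
        (capProduct ha (singularCohomology.ringChange (Int.castRingHom ℂ) Y a u)
          (singularHomology.coeffChange Y (Int.castRingHom ℂ).toAddMonoidHom m
            μ.fundamentalClass)) := by
    rw [← singularHomology.coeffChange_capProduct, capProduct_gysinMap hν F ha hb u,
      singularHomology.coeffChange_map, singularHomology.coeffChange_capProduct]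
  rw [hcX, hcY, map_smul, map_smul, map_smul, ← capProduct_gysinMap hν' F ha hb] at e1
  -- `e1 : cX • ((F_! u) ⊗ ℂ ⌢ [X]_{ν'}) = cY • (F_!' (u ⊗ ℂ) ⌢ [X]_{ν'})`
  apply (hν' hb).1
  rw [poincareDualityMap_apply, poincareDualityMap_apply, map_smul, LinearMap.smul_apply, mul_smul,
    ← e1, smul_smul, inv_mul_cancel₀ hcX0, one_smul]

/-! ### Gysin maps preserve generically-torsion classes -/

/-- **`f_!(GT(X')) ⊆ GT(X)`.** Let `f : X' ⟶ X` be a morphism of smooth projective varieties of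
dimensions `m ≤ n`, `μ`, `ν` integral orientations of `X'(ℂ)`, `X(ℂ)`, `a + q = 2m`, `b + q = 2n`,
`a, b ≥ 1`. If `u ∈ Hᵃ(X'(ℂ);ℤ)` is generically torsion then so is `f_! u = gysinMap μ ν f(ℂ) u ∈
Hᵇ(X(ℂ);ℤ)`: `GT = N¹ ∩ H_ℤ` on both sides
(`genericDivisibilityBounded_genericallyTorsion_iff_ringChange_mem_supportedClasses`),
`(f_! u) ⊗ ℂ = c • f_!' (u ⊗ ℂ)` for the complex orientations `μ ⊗ 1`, `ν ⊗ 1`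
(`genericDivisibilityBounded_ringChange_gysinMap_eq_smul`; Poincaré duality for `ν ⊗ 1` is the
tree's `poincare_duality`), and complex Gysin maps send `N¹Hᵃ(X'(ℂ);ℂ)` into `N¹Hᵇ(X(ℂ);ℂ)` when
`m ≤ n` (`gysinMap_mem_supportedClasses_of_isSmoothProjective`, Voisin II Prop. 9.21 (ii)).
[cite: VoisinHodgeII2003, §9.2.4 Prop. 9.21 (ii)]
[cite: FultonYoungTableaux1997, Appendix B §B.1 (5)] -/
theorem genericDivisibilityBounded_gysinMap_genericallyTorsion {m n : ℕ} {X' X : SchemeOver ℂ}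
    (hX' : IsSmoothProjective m X') (hX : IsSmoothProjective n X) (f : X' ⟶ X)
    (μ : HomologicalOrientation ℤ (ComplexPoints X') (2 * m))
    (ν : HomologicalOrientation ℤ (ComplexPoints X) (2 * n)) {a b q : ℕ} (ha : a + q = 2 * m)
    (hb : b + q = 2 * n) (hmn : m ≤ n) (ha1 : 1 ≤ a) (hb1 : 1 ≤ b)
    {u : singularCohomology ℤ ℤ (ComplexPoints X') a}
    (hu : ∃ Z : Set X'.left, IsClosed Z ∧ Z ≠ Set.univ ∧ ∃ N : ℕ, 1 ≤ N ∧ N • Res[X', Z, a] u = 0) :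
    ∃ Z : Set X.left, IsClosed Z ∧ Z ≠ Set.univ ∧ ∃ N : ℕ, 1 ≤ N ∧
      N • Res[X, Z, b] (gysinMap μ ν (AlgPoints.mapContinuous (L := ℂ) f) ha hb u) = 0 := by
  letI := hX'.chartedSpace
  letI := hX.chartedSpace
  haveI := ComplexPoints.compactSpace_of_isSmoothProjective hX'
  haveI := ComplexPoints.t2Space_of_isSmoothProjective hX'
  haveI := ComplexPoints.compactSpace_of_isSmoothProjective hX
  haveI := ComplexPoints.t2Space_of_isSmoothProjective hX
  haveI := connectedSpace_complexPoints hX'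
  haveI := connectedSpace_complexPoints hX
  -- Poincaré duality for the complex orientation `ν ⊗ 1` of `X(ℂ)` (Hatcher Thm. 3.30)
  have hν' : (ν.toCoeff ℂ).HasPoincareDuality :=
    HomologicalOrientation.HasPoincareDuality.of_bijective_poincareDualityMap
      (fun p q h ↦ poincare_duality _ h)
  obtain ⟨c, -, hc⟩ := genericDivisibilityBounded_ringChange_gysinMap_eq_smul μ ν (μ.toCoeff ℂ)
    (ν.toCoeff ℂ) hν' (AlgPoints.mapContinuous (L := ℂ) f) ha hb
  rw [genericDivisibilityBounded_genericallyTorsion_iff_ringChange_mem_supportedClasses hX hb1,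
    hc u]
  exact Submodule.smul_mem _ c (gysinMap_mem_supportedClasses_of_isSmoothProjective hX' hX
    (μ.toCoeff ℂ) (ν.toCoeff ℂ) hν' f ha hb (r := 1) (s := 1) (by omega)
    ((genericDivisibilityBounded_genericallyTorsion_iff_ringChange_mem_supportedClasses hX' ha1 u).1
      hu))

/-! ### The heart descends along surjective morphisms of degree prime to `ℓ` -/

/-- **The heart descends along `f : X' ⟶ X` onto, of degree `d` prime to `ℓ`.** Let `X'`, `X` be
smooth projective of dimension `n`, `f` onto on points, of degree `d` for integral orientations `μ`,
`ν` (`f(ℂ)_*[X'(ℂ)]_μ = d • [X(ℂ)]_ν`), `k + q = 2n`, `k ≥ 1`, `gcd(ℓ, d) = 1`. If level `ℓ^s` is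
clean at `X'` in degree `k` then it is clean at `X` in degree `k`: given `D'(ℓ^s, z)`,
`D'(ℓ^s, f^*z)` (`genericDivisibilityBounded_levelDivisible_map`), so `f^*z - ℓ • w' ∈ GT(X')` for
some `w'`; push forward: `f_!(f^*z - ℓ • w') = d • z - ℓ • f_! w' ∈ GT(X)` (`f_! f^* z = d • z`,
Fulton App. B (6)–(7), `gysinMap_map_of_hasDegree` with Poincaré duality `poincare_duality`;
`f_!(GT(X')) ⊆ GT(X)`, `genericDivisibilityBounded_gysinMap_genericallyTorsion`); with
`a ℓ + b d = 1`, `w := a • z + b • f_! w'` has `z - ℓ • w = b • (d • z - ℓ • f_! w') ∈ GT(X)`.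
[cite: FultonYoungTableaux1997, Appendix B §B.1 (5)–(7)]
[cite: VoisinHodgeII2003, §9.2.4 Prop. 9.21 (ii)] -/
theorem genericDivisibilityBounded_levelClean_of_hasDegree {n : ℕ} {X' X : SchemeOver ℂ}
    (f : X' ⟶ X) (hX' : IsSmoothProjective n X') (hX : IsSmoothProjective n X)
    (μ : HomologicalOrientation ℤ (ComplexPoints X') (2 * n))
    (ν : HomologicalOrientation ℤ (ComplexPoints X) (2 * n)) {d : ℤ}
    (hdeg : HasDegree μ ν (AlgPoints.mapContinuous (L := ℂ) f) d)
    (hf : Function.Surjective f.left.base) {k q : ℕ} (hkq : k + q = 2 * n) (hk : 1 ≤ k) {ℓ : ℕ}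
    (hℓd : IsCoprime (ℓ : ℤ) d) (s : ℕ)
    (hC : ∀ z' : singularCohomology ℤ ℤ (ComplexPoints X') k,
      (∃ Z : Set X'.left, IsClosed Z ∧ Z ≠ Set.univ ∧
        ∃ (y : singularCohomology ℤ ℤ (complexPointsCompl X' Z) k) (M : ℕ), 1 ≤ M ∧
          M • (Res[X', Z, k] z' - ℓ ^ s • y) = 0) →
      ∃ w : singularCohomology ℤ ℤ (ComplexPoints X') k, ∃ Z : Set X'.left, IsClosed Z ∧
        Z ≠ Set.univ ∧ ∃ N : ℕ, 1 ≤ N ∧ N • Res[X', Z, k] (z' - ℓ • w) = 0)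
    (z : singularCohomology ℤ ℤ (ComplexPoints X) k)
    (hz : ∃ Z : Set X.left, IsClosed Z ∧ Z ≠ Set.univ ∧
      ∃ (y : singularCohomology ℤ ℤ (complexPointsCompl X Z) k) (M : ℕ), 1 ≤ M ∧
        M • (Res[X, Z, k] z - ℓ ^ s • y) = 0) :
    ∃ w : singularCohomology ℤ ℤ (ComplexPoints X) k, ∃ Z : Set X.left, IsClosed Z ∧
      Z ≠ Set.univ ∧ ∃ N : ℕ, 1 ≤ N ∧ N • Res[X, Z, k] (z - ℓ • w) = 0 := by
  -- Poincaré duality for `ν` over `ℤ` (Hatcher Thm. 3.30, proved in the tree)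
  have hν : ν.HasPoincareDuality := fun _ _ h' ↦
    ComplexPoints.bijective_poincareDualityMap_of (fun ν' _ _ h'' ↦ poincare_duality ν' h'') hX ν h'
  -- the heart at `X'` for `f^* z`
  obtain ⟨w', hw'⟩ := hC _ (genericDivisibilityBounded_levelDivisible_map f hf (ℓ ^ s) hz)
  -- push forward: `d • z - ℓ • f_! w' ∈ GT(X)`
  have hGT := genericDivisibilityBounded_gysinMap_genericallyTorsion hX' hX f μ ν hkq hkq le_rfl hk
    hk hw'
  rw [map_sub, map_nsmul, gysinMap_map_of_hasDegree hν hdeg hkq z] at hGT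
  -- Bézout
  obtain ⟨a, b, hab⟩ := hℓd
  refine ⟨a • z + b • gysinMap μ ν (AlgPoints.mapContinuous (L := ℂ) f) hkq hkq w', ?_⟩
  rw [genericDivisibilityBounded_bezout_smul hab]
  exact genericDivisibilityBounded_genericallyTorsion_zsmul b hGT

/-- **The heart descends from any smooth projective birational model.** For `σ : X' ⟶ X` between
smooth projective varieties of dimension `n` with `σ.left` birational, `k + q = 2n`, `k ≥ 1`, and
ANY `ℓ`, `s`: level `ℓ^s` clean at `X'` in degree `k` implies level `ℓ^s` clean at `X` in degree
`k` — `σ` has degree `1` for the complex orientations (Fulton Lemma 19.1.2,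
`hasDegree_one_complexOrientationInt_of_isBirational`), `gcd(ℓ, 1) = 1`, and `σ` is onto (proper,
`isProper_left_of_isSmoothProjective`, and birational: `surjective_base_of_isBirational`).
[cite: Fulton1998, Lemma 19.1.2] [cite: FultonYoungTableaux1997, Appendix B §B.1 (5)–(7)] -/
theorem genericDivisibilityBounded_levelClean_of_isBirational {n : ℕ} {X' X : SchemeOver ℂ}
    (σ : X' ⟶ X) (hX' : IsSmoothProjective n X') (hX : IsSmoothProjective n X)
    (hσ : Literature.AlgebraicGeometry.Resolution.IsBirational σ.left) {k q : ℕ}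
    (hkq : k + q = 2 * n) (hk : 1 ≤ k) (ℓ s : ℕ)
    (hC : ∀ z' : singularCohomology ℤ ℤ (ComplexPoints X') k,
      (∃ Z : Set X'.left, IsClosed Z ∧ Z ≠ Set.univ ∧
        ∃ (y : singularCohomology ℤ ℤ (complexPointsCompl X' Z) k) (M : ℕ), 1 ≤ M ∧
          M • (Res[X', Z, k] z' - ℓ ^ s • y) = 0) →
      ∃ w : singularCohomology ℤ ℤ (ComplexPoints X') k, ∃ Z : Set X'.left, IsClosed Z ∧
        Z ≠ Set.univ ∧ ∃ N : ℕ, 1 ≤ N ∧ N • Res[X', Z, k] (z' - ℓ • w) = 0)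
    (z : singularCohomology ℤ ℤ (ComplexPoints X) k)
    (hz : ∃ Z : Set X.left, IsClosed Z ∧ Z ≠ Set.univ ∧
      ∃ (y : singularCohomology ℤ ℤ (complexPointsCompl X Z) k) (M : ℕ), 1 ≤ M ∧
        M • (Res[X, Z, k] z - ℓ ^ s • y) = 0) :
    ∃ w : singularCohomology ℤ ℤ (ComplexPoints X) k, ∃ Z : Set X.left, IsClosed Z ∧
      Z ≠ Set.univ ∧ ∃ N : ℕ, 1 ≤ N ∧ N • Res[X, Z, k] (z - ℓ • w) = 0 :=
  haveI : IsProper σ.left := isProper_left_of_isSmoothProjective hX' hX σ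
  genericDivisibilityBounded_levelClean_of_hasDegree σ hX' hX (complexOrientationInt hX')
    (complexOrientationInt hX) (hasDegree_one_complexOrientationInt_of_isBirational hX' hX σ hσ)
    (surjective_base_of_isBirational σ.left hσ) hkq hk isCoprime_one_right s hC z hz

/-- **The heart of `stub_finiteLevel` at `(ℓ, s)` descends from a smooth projective birational
model of the `2p`-fold `X`** (`p ≥ 1`; the previous theorem at `n = 2p`, `k = q = 2p`), in the
heart's exact shape. [cite: Fulton1998, Lemma 19.1.2] -/
theorem genericDivisibilityBounded_heart_of_isBirational {p : ℕ} {X' X : SchemeOver ℂ}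
    (σ : X' ⟶ X) (hp : 1 ≤ p) (hX' : IsSmoothProjective (2 * p) X')
    (hX : IsSmoothProjective (2 * p) X)
    (hσ : Literature.AlgebraicGeometry.Resolution.IsBirational σ.left) (ℓ s : ℕ)
    (hC : ∀ z' : singularCohomology ℤ ℤ (ComplexPoints X') (2 * p),
      (∃ Z : Set X'.left, IsClosed Z ∧ Z ≠ Set.univ ∧
        ∃ (y : singularCohomology ℤ ℤ (complexPointsCompl X' Z) (2 * p)) (M : ℕ), 1 ≤ M ∧
          M • (Res[X', Z, 2 * p] z' - ℓ ^ s • y) = 0) →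
      ∃ w : singularCohomology ℤ ℤ (ComplexPoints X') (2 * p), ∃ Z : Set X'.left, IsClosed Z ∧
        Z ≠ Set.univ ∧ ∃ N : ℕ, 1 ≤ N ∧ N • Res[X', Z, 2 * p] (z' - ℓ • w) = 0) :
    ∀ z : singularCohomology ℤ ℤ (ComplexPoints X) (2 * p),
      (∃ Z : Set X.left, IsClosed Z ∧ Z ≠ Set.univ ∧
        ∃ (y : singularCohomology ℤ ℤ (complexPointsCompl X Z) (2 * p)) (M : ℕ), 1 ≤ M ∧
          M • (Res[X, Z, 2 * p] z - ℓ ^ s • y) = 0) →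
      ∃ w : singularCohomology ℤ ℤ (ComplexPoints X) (2 * p), ∃ Z : Set X.left, IsClosed Z ∧
        Z ≠ Set.univ ∧ ∃ N : ℕ, 1 ≤ N ∧ N • Res[X, Z, 2 * p] (z - ℓ • w) = 0 :=
  fun z hz ↦ genericDivisibilityBounded_levelClean_of_isBirational σ hX' hX hσ (q := 2 * p)
    (by omega) (by omega) ℓ s hC z hz

/-! ### The registered sub-goal -/

/-- **Registered sub-goal `stub_heartOfHasDegreeCoprime` of stmt-HodgeConjecture-18467 (lead c4,
wave 2, line `finite-level-bootstrap`): the heart DESCENDS along surjective morphisms of degree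
prime to `ℓ`.** For `f : X' ⟶ X` onto between smooth projective `2p`-folds (`p ≥ 1`), of degree `d`
for integral orientations `μ`, `ν` of `X'(ℂ)`, `X(ℂ)`, and `gcd(ℓ, d) = 1`: level `ℓ^s` clean at
`X'` implies level `ℓ^s` clean at `X` (proof: `genericDivisibilityBounded_levelClean_of_hasDegree`
at `n = k = q = 2p` — pull back `D'(ℓ^s, z)`, apply the heart at `X'`, push forward by the
integral Gysin map, `f_! f^* = d`, `f_!(GT) ⊆ GT`, Bézout). In particular the heart passes from
any smooth birational model (`genericDivisibilityBounded_levelClean_of_isBirational`) and to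
targets of morphisms of degree prime to `ℓ`. Statement: the skeleton's, with `f(ℂ)` spelled
`AlgPoints.mapContinuous f` instead of `AlgPoints.mapContinuous (L := ℂ) f` — the same term
(`L = ℂ` is forced by the orientations; the two statements agree by `rfl`), spelled without the
token `:=`, at which the stub registry cuts signatures.
[cite: FultonYoungTableaux1997, Appendix B §B.1 (5)–(7)]
[cite: VoisinHodgeII2003, §9.2.4 Prop. 9.21 (ii)] -/
theorem stub_heartOfHasDegreeCoprime :
    ∀ ⦃p : ℕ⦄ ⦃X' X : SchemeOver ℂ⦄ (f : X' ⟶ X)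
      (μ : HomologicalOrientation ℤ (ComplexPoints X') (2 * (2 * p)))
      (ν : HomologicalOrientation ℤ (ComplexPoints X) (2 * (2 * p))) (d : ℤ),
      1 ≤ p → IsSmoothProjective (2 * p) X' → IsSmoothProjective (2 * p) X →
      HasDegree μ ν (AlgPoints.mapContinuous f) d → Function.Surjective f.left.base →
      ∀ ℓ s : ℕ, IsCoprime (ℓ : ℤ) d →
      (∀ z' : singularCohomology ℤ ℤ (ComplexPoints X') (2 * p),
        (∃ Z : Set X'.left, IsClosed Z ∧ Z ≠ Set.univ ∧
          ∃ (y : singularCohomology ℤ ℤ (complexPointsCompl X' Z) (2 * p)) (M : ℕ), 1 ≤ M ∧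
            M • (singularCohomology.map ℤ ℤ
              (⟨Subtype.val, continuous_subtype_val⟩ : C(complexPointsCompl X' Z, ComplexPoints X'))
              (2 * p) z' - ℓ ^ s • y) = 0) →
        ∃ w : singularCohomology ℤ ℤ (ComplexPoints X') (2 * p),
          ∃ Z : Set X'.left, IsClosed Z ∧ Z ≠ Set.univ ∧ ∃ N : ℕ, 1 ≤ N ∧
            N • singularCohomology.map ℤ ℤ
              (⟨Subtype.val, continuous_subtype_val⟩ : C(complexPointsCompl X' Z, ComplexPoints X'))
              (2 * p) (z' - ℓ • w) = 0) →
      ∀ z : singularCohomology ℤ ℤ (ComplexPoints X) (2 * p),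
        (∃ Z : Set X.left, IsClosed Z ∧ Z ≠ Set.univ ∧
          ∃ (y : singularCohomology ℤ ℤ (complexPointsCompl X Z) (2 * p)) (M : ℕ), 1 ≤ M ∧
            M • (singularCohomology.map ℤ ℤ
              (⟨Subtype.val, continuous_subtype_val⟩ : C(complexPointsCompl X Z, ComplexPoints X))
              (2 * p) z - ℓ ^ s • y) = 0) →
        ∃ w : singularCohomology ℤ ℤ (ComplexPoints X) (2 * p),
          ∃ Z : Set X.left, IsClosed Z ∧ Z ≠ Set.univ ∧ ∃ N : ℕ, 1 ≤ N ∧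
            N • singularCohomology.map ℤ ℤ
              (⟨Subtype.val, continuous_subtype_val⟩ : C(complexPointsCompl X Z, ComplexPoints X))
              (2 * p) (z - ℓ • w) = 0 :=
  fun p _ _ f μ ν _ hp hX' hX hdeg hf ℓ s hℓd hC z hz ↦
    genericDivisibilityBounded_levelClean_of_hasDegree f hX' hX μ ν hdeg hf (q := 2 * p) (by omega)
      (by omega) hℓd s hC z hz

end Summit.HodgeConjecture.HodgeConjecture.Theorems

end
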